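import Summits.BirchSwinnertonDyer.BirchSwinnertonDyer.Theorems.PlecticRankUB.Negative.PlecticRankUBFalseWithoutAnalyticRank
import Literature.NumberTheory.DiophantineGeometry.LocalReduction

/-!
# Negative lemma for line `Sketch` of crux `PlecticLegs.PlecticRankUB` (stmt-BirchSwinnertonDyer-17519):
# stub S2 `stub_offSector` is false without the analytic-rank hypothesis — the off-sector
# restriction buys nothing on the Mordell–Weil side

Refuter / crux-disprover file (Negative lane, supports stmt-BirchSwinnertonDyer-17519; it refutes
neither the crux nor the stub). The lead's skeleton (`Cruxes/PlecticRankUB/Lines/Sketch.lean`, line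
`exceptional-legs-plectic-cap`) cuts the crux along the PLECTIC MULTIPLICATIVE SECTOR
`∃ p, ∃ S, [F:ℚ] ≤ #S + 1 ∧ ∀ v ∈ S, p ∈ v ∧ V multiplicative at v`; stub **S2** `stub_offSector` is
the crux OFF that sector. We record, sorry-free:

* `PlecticRankUBNegative.not_hasMultiplicativeReductionAt_of_c₆_eq_zero` — a Weierstrass curve over
  a number field with `c₆ = 0` (the `j = 1728` family, e.g. every congruent number curve and all its
  base changes) has multiplicative reduction at NO finite place: for the local minimal model `W'`,
  `c₆(W') = u⁻⁶ c₆ = 0`, so `1728 Δ(W') = c₄(W')³` (`WeierstrassCurve.c_relation`), and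
  `ord_v c₄(W') = 0` would force `ord_v(1728) + ord_v Δ(W') = 0`, against `ord_v Δ(W') > 0`.
  Hence every such curve lies OFF the sector, for every `F` and every `d ≥ 2`.
* `stub_offSector_false_without_analyticRank` — the statement of S2 with the hypothesis
  `V.analyticRank = [F:ℚ]` deleted is FALSE: the witness of
  `plecticRankUB_false_without_analyticRank` (`F = ℚ(√5)`, `V = E₁₂₅₄ ⊗ F`, rank `≥ 3 > 2`) is
  off-sector by the first bullet.

Consequences for the lead: (i) S2 is not eased by its sector hypothesis — the whole potentially-good
(`j ∈ 𝓞_F`) world, in particular every CM curve with `j = 1728` or `j = 0` and every base change of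
it, sits inside S2, with ranks exceeding `d` as soon as the analytic hypothesis is dropped; any proof
of S2 must, like the crux, consume the exact order of vanishing. (ii) Conversely the line's engine
(S1, multiplicative legs) never sees these curves: on the `j = 1728` family the skeleton IS S2.
[folklore]
-/

noncomputable section

open scoped Classical

open WeierstrassCurve IsDedekindDomain IsDedekindDomain.HeightOneSpectrum NumberField
open Literature.NumberTheory.EllipticCurves
open Literature.Barriers.BirchSwinnertonDyer.DokchitserDokchitser2011

namespace Summit.BirchSwinnertonDyer.BirchSwinnertonDyer.Theorems

/-- **`c₆ = 0` excludes multiplicative reduction at every finite place** (the `j = 1728` family has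
potentially good reduction everywhere; Silverman AEC VII.5.1 with `1728 Δ = c₄³ − c₆²`). For the
local minimal model `W'` at `v`: `c₆(W') = 0`, `1728 Δ(W') = c₄(W')³`; multiplicative reduction
(`ord_v Δ(W') > 0`, `ord_v c₄(W') = 0`) would give `v(1728)·v(Δ(W')) = 1` with `v(1728) ≤ 1` and
`v(Δ(W')) < 1`, absurd. [cite: SilvermanAEC2009, Prop. VII.5.1] -/
theorem PlecticRankUBNegative.not_hasMultiplicativeReductionAt_of_c₆_eq_zero
    {K : Type*} [Field K] [NumberField K] (W : WeierstrassCurve K) (hc₆ : W.c₆ = 0)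
    (v : HeightOneSpectrum (𝓞 K)) : ¬ W.HasMultiplicativeReductionAt v := by
  intro h
  have h' : (W.localMinimalModel v).HasMultiplicativeReduction (v.adicCompletionIntegers K) := h
  have hbad := h'.badReduction
  have hc4 := h'.multiplicativeReduction
  -- `c₆` of the local minimal model vanishes
  have hc₆' : (W.localMinimalModel v).c₆ = 0 := by
    simp only [WeierstrassCurve.localMinimalModel, WeierstrassCurve.minimal, variableChange_c₆,
      WeierstrassCurve.baseChange, map_c₆, hc₆, map_zero, mul_zero]
  -- `1728 Δ' = c₄'³`
  have hrel : (1728 : v.adicCompletion K) * (W.localMinimalModel v).Δ =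
      (W.localMinimalModel v).c₄ ^ 3 := by
    have := (W.localMinimalModel v).c_relation
    rw [hc₆'] at this
    linear_combination this
  have h1728 : valuation (v.adicCompletion K)
      (IsDiscreteValuationRing.maximalIdeal (v.adicCompletionIntegers K))
      (1728 : v.adicCompletion K) ≤ 1 := by
    have := valuation_le_one (K := v.adicCompletion K)
      (IsDiscreteValuationRing.maximalIdeal (v.adicCompletionIntegers K))
      ((1728 : ℕ) : v.adicCompletionIntegers K)
    exact_mod_cast this
  have key := congrArg (valuation (v.adicCompletion K)
      (IsDiscreteValuationRing.maximalIdeal (v.adicCompletionIntegers K))) hrel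
  simp only [map_mul, map_pow, hc4, one_pow] at key
  have hlt : valuation (v.adicCompletion K)
      (IsDiscreteValuationRing.maximalIdeal (v.adicCompletionIntegers K))
        (1728 : v.adicCompletion K) *
      valuation (v.adicCompletion K)
        (IsDiscreteValuationRing.maximalIdeal (v.adicCompletionIntegers K))
          (W.localMinimalModel v).Δ < 1 :=
    calc _ ≤ 1 * valuation (v.adicCompletion K)
          (IsDiscreteValuationRing.maximalIdeal (v.adicCompletionIntegers K))
            (W.localMinimalModel v).Δ := mul_le_mul_left h1728 _
      _ = _ := one_mul _
      _ < 1 := hbad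
  exact absurd key hlt.ne

/-- `c₆(E_n) = 0` for the congruent number curves `y² = x³ − n² x` (`j = 1728`). [folklore] -/
theorem PlecticRankUBNegative.c₆_congruentNumberCurve (n : ℕ) : (congruentNumberCurve n).c₆ = 0 := by
  simp [WeierstrassCurve.c₆, WeierstrassCurve.b₂, WeierstrassCurve.b₄, WeierstrassCurve.b₆,
    congruentNumberCurve]

/-- **The off-sector witness.** There is a totally real number field `F` of degree `2` and an
elliptic curve `V/F` with `c₆(V) = 0` (hence multiplicative reduction nowhere) and
`rank_ℤ V(F) ≥ 3`: `F = ℚ(√5)`, `V = E₁₂₅₄ ⊗ F`. [folklore] -/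
theorem PlecticRankUBNegative.exists_offSector_witness :
    ∃ (F : Type) (_ : Field F) (_ : NumberField F), NumberField.IsTotallyReal F ∧
      Module.finrank ℚ F = 2 ∧ ∃ V : WeierstrassCurve F, V.IsElliptic ∧ V.c₆ = 0 ∧
        3 ≤ V.mordellWeilRank := by
  obtain ⟨K, _, _, h2, hdK⟩ :=
    Literature.NumberTheory.QuadraticFields.Quadratic.exists_numberField_discr_eq (D := 5)
      (Or.inl ⟨by norm_num, by rw [← Int.squarefree_natAbs]; exact Nat.prime_five.squarefree,
        by norm_num⟩)
  have hreal : NumberField.IsTotallyReal K := by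
    rw [← NumberField.nrComplexPlaces_eq_zero_iff]
    have hsign := NumberField.sign_discr K
    rw [hdK] at hsign
    have heven : Even (NumberField.InfinitePlace.nrComplexPlaces K) := by
      by_contra hodd
      rw [Nat.not_even_iff_odd] at hodd
      rw [hodd.neg_one_pow] at hsign
      norm_num at hsign
    have hrk := NumberField.InfinitePlace.card_add_two_mul_card_eq_rank K
    rw [h2] at hrk
    obtain ⟨m, hm⟩ := heven
    omega
  haveI hE : (congruentNumberCurve 1254).IsElliptic := isElliptic_congruentNumberCurve (by norm_num)
  refine ⟨K, inferInstance, inferInstance, hreal, h2, (congruentNumberCurve 1254).baseChange K,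
    inferInstanceAs ((congruentNumberCurve 1254).map (algebraMap ℚ K)).IsElliptic, ?_, ?_⟩
  · rw [WeierstrassCurve.baseChange, map_c₆, PlecticRankUBNegative.c₆_congruentNumberCurve,
      map_zero]
  · have hmono := mordellWeilRank_baseChange_le_of_algHom (F := K) (congruentNumberCurve 1254)
      (Algebra.ofId ℚ K)
    have hid : (congruentNumberCurve 1254).baseChange ℚ = congruentNumberCurve 1254 := by
      rw [WeierstrassCurve.baseChange, RingHom.ext_rat (algebraMap ℚ ℚ) (RingHom.id ℚ),
        WeierstrassCurve.map_id]
    rw [hid] at hmono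
    exact PlecticRankUBNegative.three_le_mordellWeilRank_1254.trans hmono

/-- **Stub S2 `stub_offSector` of line `Sketch` is false without the analytic-rank hypothesis**
(negative lemma supporting stmt-BirchSwinnertonDyer-17519; not a refutation of the stub or the
crux). The negated statement is the registered signature of `stub_offSector` verbatim with the
single hypothesis `V.analyticRank = Module.finrank ℚ F` deleted. Witness: `F = ℚ(√5)`,
`V = E₁₂₅₄ ⊗ F`: off the plectic multiplicative sector at every prime (`c₆ = 0`), of rank
`≥ 3 > 2 = [F:ℚ]`. [folklore] -/
theorem stub_offSector_false_without_analyticRank :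
    ¬ (∀ (F : Type) [Field F] [NumberField F] [NumberField.IsTotallyReal F] (V : WeierstrassCurve F)
      [V.IsElliptic], 2 ≤ Module.finrank ℚ F →
      ¬ (∃ p : ℕ, p.Prime ∧ ∃ S : Finset (HeightOneSpectrum (𝓞 F)),
          Module.finrank ℚ F ≤ S.card + 1 ∧
            ∀ v ∈ S, (p : 𝓞 F) ∈ v.asIdeal ∧ V.HasMultiplicativeReductionAt v) →
      V.mordellWeilRank ≤ Module.finrank ℚ F) := by
  intro h
  obtain ⟨F, _, _, hreal, h2, V, hV, hc₆, h3⟩ := PlecticRankUBNegative.exists_offSector_witness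
  haveI := hreal
  haveI := hV
  have hoff : ¬ (∃ p : ℕ, p.Prime ∧ ∃ S : Finset (HeightOneSpectrum (𝓞 F)),
      Module.finrank ℚ F ≤ S.card + 1 ∧
        ∀ v ∈ S, (p : 𝓞 F) ∈ v.asIdeal ∧ V.HasMultiplicativeReductionAt v) := by
    rintro ⟨p, -, S, hS, hmult⟩
    rw [h2] at hS
    obtain ⟨v, hv⟩ : S.Nonempty := Finset.card_pos.mp (by omega)
    exact PlecticRankUBNegative.not_hasMultiplicativeReductionAt_of_c₆_eq_zero V hc₆ v (hmult v hv).2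
  have hle := h F V (by omega) hoff
  omega

end Summit.BirchSwinnertonDyer.BirchSwinnertonDyer.Theorems

end
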